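import Literature.AlgebraicGeometry.Deformation.ExtensionAutomorphismsClosedFibreQuot
import Mathlib.LinearAlgebra.TensorProduct.Associator
import Mathlib.LinearAlgebra.TensorProduct.Tower
import HarnessLib

/-!
# The residue-field dictionary for the quotient-currency obstruction calculus: `Der_{A'}(B₀, B₀ ⊗_{A'} J) = Der_κ(B₀, B₀ ⊗_κ J)`
# (Hartshorne, *Deformation Theory*, Notation 6.1 «`J` can be considered as a `k`-vector space», Ex. 3.8 «Base Change II»;
# [Oort1971] §2.2: the obstruction lives in `H²(X_k, Θ) ⊗_k J`)

Layer `Literature/AlgebraicGeometry/Deformation`, namespace `Literature.AlgebraicGeometry.Deformation.DerivationsResidueQuot`.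
PROOF FILE, THEOREMS ONLY (no definition, no instance, no notation, no named fact, no `sorry`); every equivalence is CHARACTERISED and
quantified (`∃`, `∃!`), with Mathlib's constructions (`Derivation.restrictScalars`, `LinearEquiv.compDer`, `TensorProduct.equivOfCompatibleSMul`,
`TensorProduct.AlgebraTensorModule.congr`) named in the proofs.

WHY.  The ★ quotient-currency trio (`ExtensionIdealTensorClosedFibreQuot`, `ExtensionAutomorphismsClosedFibreQuot`,
`SmoothLiftObstructionCocycleQuot`) reads the obstruction cocycle as `A'`-derivations `δ : Derivation A' B₀ (B₀ ⊗[A'] ↥J)` of the closed fibre —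
everything `A'`-linear, no residue FIELD named.  The abelian vanishing (U-ab) («`[−1]^*` acts by `−1` on `H²(X_κ, Θ) ⊗_κ J`», [Oort1971] pp. 279–280)
computes over the residue field `κ = A' ⧸ 𝔪`, in the currency `Derivation κ B₀ (B₀ ⊗[κ] J)` of the ★ field-level files (`SmoothAffineDeformation*`,
`AbelianObstruction*`).  THIS FILE is the bridge, for ANY commutative `A'`-algebra `κ` whose structure map is ONTO (no quotient model is
chosen; the kernel `𝔪` enters only through the `κ`-module structures the consumer supplies):

* §1 **`Derivation A' B₀ M = Derivation κ B₀ M`** for a `κ`-algebra `B₀` and a `κ`-module `M` (compatible `A'`-structures): an `A'`-derivation is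
  `κ`-linear (`map_smul_of_surjective`), hence is the restriction of scalars of a UNIQUE `κ`-derivation (`existsUnique_extendScalars`,
  Mathlib `Derivation.restrictScalars` for the converse; `eq_of_restrictScalars_eq`) — [Hartshorne2010] Ex. 3.8 «Base Change II», `i = 0`,
  along `A' ↠ κ`.
* §2 **`B₀ ⊗[A'] ↥J ≃ B₀ ⊗[κ] Jκ`** for any `κ`-module `Jκ` with an `A'`-linear `↥J ≃ₗ[A'] Jκ` («`J` can be considered as a `k`-vector space»):
  `B₀`-linear, `b ⊗ j ↦ b ⊗ φ j`, unique (Mathlib `TensorProduct.equivOfCompatibleSMul` — tensoring over `A'` or over its quotient `κ` is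
  the same — after `TensorProduct.CompatibleSMul.of_algebraMap_surjective`; the `CompatibleSMul` instance is taken as a BINDER and supplied by
  `compatibleSMul_of_surjective`).
* §3 **TRANSPORT OF READINGS**: every `δ : Derivation A' B₀ (B₀ ⊗[A'] ↥J)` is `e⁻¹ ∘ δκ` for a unique `δκ : Derivation κ B₀ (B₀ ⊗[κ] Jκ)`
  (`existsUnique_transport`); in particular the reading of an automorphism over the identity (★ `autOverIdentityMulEquiv`) has a unique
  residue-field form (`existsUnique_residueReading`), additive in the automorphism.

Cell `hodgecm-mathlib`, P6 sub-desk P6b, LEAD word «M-122» deal #4 (U-κ): generic organ capital on the road to (U) =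
`Cruxes/HLiu418/Lines/F0_P6b_BTSerreTate.stub_L4B1u_abelianLiftOfIsUnitTwo` (banked); count-neutral.  HC_CM is proved only modulo the printed
citations until rung 0 closes; nothing here bears on a summit statement.

## References
* [Hartshorne2010] R. Hartshorne, *Deformation Theory*, GTM 257, Springer (2010): Ex. 3.8 (p. 26), Notation 6.1 (p. 46), Remark 10.1.1 (p. 81).
* [Oort1971] F. Oort, *Finite group schemes, local moduli for abelian varieties, and lifting problems*, Compositio Math. 23 (1971), §2.2
  (pp. 277–280).
-/

noncomputable section

open TensorProduct

namespace Literature.AlgebraicGeometry.Deformation.DerivationsResidueQuot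

open Literature.AlgebraicGeometry.Deformation.ExtensionAutomorphisms Literature.AlgebraicGeometry.Deformation.ExtensionAutomorphismsQuot

variable {A' : Type*} [CommRing A'] {κ : Type*} [CommRing κ] [Algebra A' κ]
variable {B₀ : Type*} [CommRing B₀] [Algebra A' B₀] [Algebra κ B₀] [IsScalarTower A' κ B₀]

/-! ## §1 `A'`-derivations of a `κ`-algebra are `κ`-derivations (`A' ↠ κ`) -/

section Derivations

variable {M : Type*} [AddCommGroup M] [Module A' M] [Module κ M] [IsScalarTower A' κ M] [Module B₀ M]

/-- **An `A'`-derivation of a `κ`-algebra is `κ`-linear** when `A' → κ` is onto: `D (c • b) = c • D b` (`c = ā`, and `a` acts through `ā`).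
[cite: Hartshorne2010, Ex. 3.8 (i = 0), p. 26] [cite: Hartshorne2010, Notation 6.1 (p. 46)] -/
theorem map_smul_of_surjective (hκ : Function.Surjective (algebraMap A' κ)) (D : Derivation A' B₀ M) (c : κ) (b : B₀) :
    D (c • b) = c • D b := by
  obtain ⟨a, rfl⟩ := hκ c
  rw [algebraMap_smul, algebraMap_smul, Derivation.map_smul]

/-- **`Derivation A' B₀ M = Derivation κ B₀ M`:** every `A'`-derivation `D` is the restriction of scalars of a UNIQUE `κ`-derivation `δ` (`δ b = D b`).
[cite: Hartshorne2010, Ex. 3.8 (i = 0), p. 26] -/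
theorem existsUnique_extendScalars (hκ : Function.Surjective (algebraMap A' κ)) (D : Derivation A' B₀ M) :
    ∃! δ : Derivation κ B₀ M, ∀ b, δ b = D b :=
  ⟨{ toFun := D
     map_add' := map_add D
     map_smul' := fun c b => map_smul_of_surjective hκ D c b
     map_one_eq_zero' := D.map_one_eq_zero
     leibniz' := D.leibniz }, fun _ => rfl, fun _ hδ => Derivation.ext fun b => hδ b⟩

/-- The converse direction is Mathlib's `Derivation.restrictScalars`: `(δ.restrictScalars A') b = δ b`, and `restrictScalars` is INJECTIVE.
[cite: Hartshorne2010, Ex. 3.8 (i = 0), p. 26] -/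
theorem eq_of_restrictScalars_eq (δ δ' : Derivation κ B₀ M) (h : δ.restrictScalars A' = δ'.restrictScalars A') : δ = δ' :=
  Derivation.ext fun b => by
    rw [← Derivation.restrictScalars_apply A' δ b, ← Derivation.restrictScalars_apply A' δ' b, h]

/-- The extension of `D` restricts back to `D`. [cite: Hartshorne2010, Ex. 3.8 (i = 0), p. 26] -/
theorem restrictScalars_eq_of_forall_apply (D : Derivation A' B₀ M) (δ : Derivation κ B₀ M) (hδ : ∀ b, δ b = D b) :
    δ.restrictScalars A' = D :=
  Derivation.ext fun b => by rw [Derivation.restrictScalars_apply, hδ]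

end Derivations

/-! ## §2 `B₀ ⊗_{A'} J = B₀ ⊗_κ J`: tensoring over `A'` or over its quotient `κ` is the same -/

section Tensor

variable {Jκ : Type*} [AddCommGroup Jκ] [Module κ Jκ] [Module A' Jκ] [IsScalarTower A' κ Jκ]

omit [IsScalarTower A' κ B₀] in
/-- The `CompatibleSMul` instance the equivalence needs holds as soon as `A' → κ` is onto (Mathlib
`TensorProduct.CompatibleSMul.of_algebraMap_surjective`); the theorems below take it as a binder. [cite: Hartshorne2010, Notation 6.1 (p. 46)] -/
theorem compatibleSMul_of_surjective [IsScalarTower A' κ B₀] (hκ : Function.Surjective (algebraMap A' κ)) :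
    TensorProduct.CompatibleSMul A' κ B₀ Jκ :=
  TensorProduct.CompatibleSMul.of_algebraMap_surjective B₀ Jκ hκ

/-- **«`J` can be considered as a `k`-vector space»: `B₀ ⊗[A'] ↥J ≃ B₀ ⊗[κ] Jκ`, `B₀`-linear, `b ⊗ j ↦ b ⊗ φ j`**, for any `κ`-module `Jκ` with an
`A'`-linear identification `φ : ↥J ≃ₗ[A'] Jκ` (Mathlib `TensorProduct.AlgebraTensorModule.congr` then `TensorProduct.equivOfCompatibleSMul`).
[cite: Hartshorne2010, Notation 6.1 (p. 46)] [cite: Hartshorne2010, Remark 10.1.1, p. 81] -/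
theorem exists_tensorEquiv [TensorProduct.CompatibleSMul A' κ B₀ Jκ] (J : Ideal A') (φ : ↥J ≃ₗ[A'] Jκ) :
    ∃ e : B₀ ⊗[A'] ↥J ≃ₗ[B₀] B₀ ⊗[κ] Jκ, ∀ (b : B₀) (j : ↥J), e (b ⊗ₜ j) = b ⊗ₜ φ j :=
  ⟨(TensorProduct.AlgebraTensorModule.congr (LinearEquiv.refl B₀ B₀) φ).trans
      (TensorProduct.equivOfCompatibleSMul A' κ B₀ B₀ Jκ).symm,
    fun b j => by
      rw [LinearEquiv.trans_apply, TensorProduct.AlgebraTensorModule.congr_tmul, LinearEquiv.refl_apply]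
      rfl⟩

omit [Algebra κ B₀] [IsScalarTower A' κ B₀] [AddCommGroup Jκ] [Module κ Jκ] [Module A' Jκ] [IsScalarTower A' κ Jκ] in
/-- Such an equivalence is UNIQUE (determined on pure tensors). [cite: Hartshorne2010, Notation 6.1 (p. 46)] -/
theorem tensorEquiv_unique {N : Type*} [AddCommGroup N] [Module B₀ N] (J : Ideal A') (φ : ↥J → Jκ) (t : B₀ → Jκ → N)
    (e e' : B₀ ⊗[A'] ↥J ≃ₗ[B₀] N) (he : ∀ (b : B₀) (j : ↥J), e (b ⊗ₜ j) = t b (φ j))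
    (he' : ∀ (b : B₀) (j : ↥J), e' (b ⊗ₜ j) = t b (φ j)) : e = e' :=
  LinearEquiv.ext fun x => by
    induction x using TensorProduct.induction_on with
    | zero => rw [map_zero, map_zero]
    | tmul b j => rw [he, he']
    | add x y hx hy => rw [map_add, map_add, hx, hy]

end Tensor

/-! ## §3 Transport of readings to the residue field -/

section Transport

variable {Jκ : Type*} [AddCommGroup Jκ] [Module κ Jκ]

/-- **Transport of readings:** for a `B₀`-linear `e : B₀ ⊗[A'] ↥J ≃ B₀ ⊗[κ] Jκ`, every `δ : Derivation A' B₀ (B₀ ⊗[A'] ↥J)` is `e⁻¹ ∘ δκ` for a UNIQUE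
`δκ : Derivation κ B₀ (B₀ ⊗[κ] Jκ)` (`δκ b = e (δ b)`; Mathlib `LinearEquiv.compDer` then §1). [cite: Hartshorne2010, Ex. 3.8 (i = 0), p. 26]
[cite: Oort1971, §2.2 (pp. 277–280)] -/
theorem existsUnique_transport (hκ : Function.Surjective (algebraMap A' κ)) (J : Ideal A')
    (e : B₀ ⊗[A'] ↥J ≃ₗ[B₀] B₀ ⊗[κ] Jκ) (δ : Derivation A' B₀ (B₀ ⊗[A'] ↥J)) :
    ∃! δκ : Derivation κ B₀ (B₀ ⊗[κ] Jκ), ∀ b, δκ b = e (δ b) := by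
  obtain ⟨δκ, hδκ, huniq⟩ := existsUnique_extendScalars (M := B₀ ⊗[κ] Jκ) hκ (e.compDer δ)
  exact ⟨δκ, fun b => (hδκ b).trans rfl, fun δ' hδ' => huniq δ' fun b => (hδ' b).trans rfl⟩

omit [Algebra A' κ] [IsScalarTower A' κ B₀] in
/-- Transport is ADDITIVE: if `δκ`, `δκ'` transport `δ`, `δ'` then `δκ + δκ'` transports `δ + δ'`. [cite: Hartshorne2010, Ex. 3.8 (i = 0), p. 26] -/
theorem transport_add (J : Ideal A') (e : B₀ ⊗[A'] ↥J ≃ₗ[B₀] B₀ ⊗[κ] Jκ)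
    {δ δ' : Derivation A' B₀ (B₀ ⊗[A'] ↥J)} {δκ δκ' : Derivation κ B₀ (B₀ ⊗[κ] Jκ)}
    (h : ∀ b, δκ b = e (δ b)) (h' : ∀ b, δκ' b = e (δ' b)) (b : B₀) : (δκ + δκ') b = e ((δ + δ') b) := by
  rw [Derivation.add_apply, Derivation.add_apply, map_add, h, h']

variable {B' : Type*} [CommRing B'] [Algebra A' B'] [Module.Flat A' B']

/-- **The residue-field reading of an automorphism over the identity:** for `θ ∈ Aut_{A'}(B')` lying over the identity of `B' ⧸ J B'` (`B'` flat,
`𝔪 J = 0`, `J ⊆ 𝔪`, closed fibre `ρ : B' ↠ B₀` a `κ`-algebra, `ker ρ = 𝔪 B'`), the ★ reading `δ_θ : Derivation A' B₀ (B₀ ⊗[A'] ↥J)`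
(★ `autOverIdentityMulEquiv`) has a UNIQUE residue-field form `δκ : Derivation κ B₀ (B₀ ⊗[κ] Jκ)`, `δκ x = e (δ_θ x)` — the element of
`T⁰(B₀/κ, J ⊗_κ B₀)` of [Hartshorne2010] Remark 10.1.1 AS PRINTED, in mixed characteristic. [cite: Hartshorne2010, Remark 10.1.1, p. 81]
[cite: Oort1971, §2.2 (pp. 277–280)] -/
theorem existsUnique_residueReading (hκ : Function.Surjective (algebraMap A' κ)) (𝔪 J : Ideal A') (h𝔪J : 𝔪 * J = ⊥)
    (hJ𝔪 : J ≤ 𝔪) (ρ : B' →ₐ[A'] B₀) (hρ : Function.Surjective ρ) (hker : RingHom.ker ρ = 𝔪.map (algebraMap A' B'))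
    (e : B₀ ⊗[A'] ↥J ≃ₗ[B₀] B₀ ⊗[κ] Jκ) (θ : autOverIdentity (B' := B') J) :
    ∃! δκ : Derivation κ B₀ (B₀ ⊗[κ] Jκ), ∀ x, δκ x = e ((autOverIdentityMulEquiv 𝔪 J h𝔪J hJ𝔪 ρ hρ hker θ).toAdd x) :=
  existsUnique_transport hκ J e _

omit [Algebra A' κ] [IsScalarTower A' κ B₀] in
/-- The residue-field reading is additive in `θ` (composition ↦ addition), as the ★ reading is.
[cite: Hartshorne2010, Remark 10.1.1, p. 81] -/
theorem residueReading_mul (𝔪 J : Ideal A') (h𝔪J : 𝔪 * J = ⊥) (hJ𝔪 : J ≤ 𝔪) (ρ : B' →ₐ[A'] B₀)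
    (hρ : Function.Surjective ρ) (hker : RingHom.ker ρ = 𝔪.map (algebraMap A' B'))
    (e : B₀ ⊗[A'] ↥J ≃ₗ[B₀] B₀ ⊗[κ] Jκ) (θ θ' : autOverIdentity (B' := B') J)
    {δκ δκ' : Derivation κ B₀ (B₀ ⊗[κ] Jκ)}
    (h : ∀ x, δκ x = e ((autOverIdentityMulEquiv 𝔪 J h𝔪J hJ𝔪 ρ hρ hker θ).toAdd x))
    (h' : ∀ x, δκ' x = e ((autOverIdentityMulEquiv 𝔪 J h𝔪J hJ𝔪 ρ hρ hker θ').toAdd x)) (x : B₀) :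
    (δκ + δκ') x = e ((autOverIdentityMulEquiv 𝔪 J h𝔪J hJ𝔪 ρ hρ hker (θ * θ')).toAdd x) := by
  rw [map_mul, toAdd_mul]
  exact transport_add J e h h' x

end Transport

end Literature.AlgebraicGeometry.Deformation.DerivationsResidueQuot

end
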